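import Summits.HodgeConjecture.CorCM.IrreducibleOddWeightsMultiplicityFamilies
import Summits.HodgeConjecture.CorCM.IrreducibleOddWeightsMultiplicityTransitive
import Literature.AlgebraicGeometry.Pohlmann1968.NondegenerateCMAlgebraTypes
import HarnessLib

/-!
# CM fields: the dimension of the Mumford–Tate group of a product of CM abelian varieties as a multiplicity count over
# irreducible `ℚ`-representations of `Aut(ℂ)`

COR-CM (cell `pub-hodgecm2`, binder seat `b16` gen 57, count-neutral claim MULTIPLICITY, file F6 — joins F4
`CorCM/IrreducibleOddWeightsMultiplicityFamilies` and F5 `…MultiplicityTransitive`, then dresses them for the action of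
`G = Aut(ℂ)` on `⊔_i Hom(K_i, ℂ)`;
theorems only, no definition, no named fact, no `sorry`).  NEW as stated, hence under `Summits/`.  HONEST FRAMING: "the
rank of a family of CM types / `dim MT` of a product of CM abelian varieties for NAMED configurations" (kernel,
unconditional) for INT-4 «what is known»; `HC_CM` is neither used nor asserted.

`rank(Φ) = CMAlgebra.cmFamilyRank Φ = dim MT(∏_i A_i)` for realisations `A_i` of `(K_i, Φ_i)` (any CM fields, any
types); `U(Σ) = antiSpan Aut(ℂ) (familyType Φ)` with `dim U(Σ) = rank(Φ) − 1 = dim Hg(∏_i A_i)`.  Local notation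
(no definition): `Ev[G, π, w] = {T w : T : ℚ^X → V equivariant}`, the slot evaluation spaces
`Ev_i(π) = Ev[Aut(ℂ), π, u_1(Φ_i)]`.

* §0 (abstract, transitive slots `X ∋ x₀` with section `s`, stabiliser `H`): **`IrrOdd.finrank_antiSpan_eq_sum_finrank_map`**
  (`dim U(Φ) = Σ_k d_k · (dim A_{Φ,k} V_k^H / δ_k)`, `A_{Φ,k} = Σ_x u_1(Φ)(x) π_k(s x)` — Mai's `rank(K, S) − 1 =
  Σ_π d_π rank π(τ)` for a NON-GALOIS field over `ℚ`, `π(τ)` replaced by `A_Φ` on the `H`-invariants) and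
  **`IrrOdd.finrank_antiSpan_sigmaType_eq_sum_finrank_map`** (families: `dim U(Σ) = Σ_k d_k · (dim Σ_i A_{i,k} V_k^{H_i} / δ_k)`).
* **`cmFamilyRank_eq_sum_add_one`** — for pairwise non-isomorphic irreducible `ℚ`-representations `(π_k, V_k)` of
  `Aut(ℂ)` covering `U(Σ)`:  **`dim MT(∏_i A_i) = 1 + Σ_k d_k · (dim Σ_i Ev_i(π_k) / δ_k)`**, `δ_k ∣ dim Σ_i Ev_i(π_k)`
  (`d_k = dim V_k`, `δ_k = dim End V_k`); ONE field: **`cmTypeRank_eq_sum_add_one`** (`dim MT(A_Φ) = 1 + Σ_k d_k ·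
  (dim Ev_Φ(π_k) / δ_k)` — Mai's Prop. 1 identity for a NON-GALOIS CM field, over `ℚ`).
* **`cmFamilyRank_eq_sum_finrank_map_add_one`** — the COMPUTABLE form: `Hom(K_i, ℂ)` is ONE `Aut(ℂ)`-orbit
  (tree `isPretransitive_ringEquiv_complex`), so with base embeddings `x_i`, sections `s_i` (`s_i(y) ∘ x_i = y`) and
  stabilisers `H_i = Aut(ℂ / x_i K_i)`:  `dim MT(∏_i A_i) = 1 + Σ_π (d_π/δ_π) · dim Σ_i A_{Φ_i} V_π^{H_i}`,
  `A_{Φ_i} = Σ_{y : K_i → ℂ} u_1(Φ_i)(y) π(s_i y)`; `exists_section_embeddings` records that sections exist.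
* **`one_add_sum_filter_le_cmFamilyRank`** — MAI'S PROP. 1 FOR PRODUCTS: `dim MT(∏_i A_i) ≥ 1 + Σ_{π touched} d_π`.

A census seat reads the irreducible `ℚ`-representations of `Aut(ℂ)` met by `U(Σ)` off a Galois model (they factor
through `Gal(L/ℚ)` for any Galois `L` containing all `K_i`; the abstract files F3–F5 hold for ANY group `G`, e.g.
`G = Gal(L/ℚ)` acting on `Hom(K_i, L)`, with `rank` transported by `Literature/…/CMTypeRankFamiliesPullback`).

## References

* [Mai1989] L. Mai, *Lower bounds for the ranks of CM types*, J. Number Theory 32 (1989), §2 Prop. 1 (proof).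
* [Deligne1982HodgeCycles] P. Deligne, *Hodge cycles on abelian varieties*, LNM 900 (1982), I Ex. 3.7 (c)
  ("`Y(G)` is the `Gal(ℚ̄/ℚ)`-module generated by `μ`": `rank = dim MT`).
* [Gordon1999HodgeAVSurvey] B. B. Gordon, *A survey of the Hodge conjecture for abelian varieties*, 7.5–7.7, 9.4.4.
* [Kubota1965] T. Kubota, *On the field extension by complex multiplication*, Trans. AMS 118 (1965), Lemma 2.
-/

set_option autoImplicit false

noncomputable section

open scoped BigOperators

open NumberField

universe u u' v w

namespace Summit.HodgeConjecture.CorCM.IrrOdd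

open Literature.NumberTheory.ComplexMultiplication

variable {G : Type w} [Group G]

/-- The orbit span `𝒪[G, w] = span_ℚ {x ↦ w (g • x) : g ∈ G}` (local notation, no definition). -/
local notation3 (prettyPrint := false) "𝒪[" G' ", " w "]" =>
  Submodule.span ℚ (Set.range fun g : G' => fun x => w (g • x))

/-- The evaluation space `Ev[G, π, w] = {T w : T equivariant}` (local notation, no definition). -/
local notation3 (prettyPrint := false) "Ev[" G' ", " π ", " w "]" =>
  Submodule.span ℚ {v | ∃ T : (_ → ℚ) →ₗ[ℚ] _,
    (∀ (g : G') (f : _ → ℚ), T (fun x => f (g⁻¹ • x)) = π g (T f)) ∧ T w = v}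

variable {X : Type v} [MulAction G X] [DecidableEq X]

/-! ### §0 The multiplicity formula on transitive slots (abstract) -/

section Formula

variable [Fintype X] {K : Type u'} [Fintype K] {W : K → Type*} [∀ k, AddCommGroup (W k)] [∀ k, Module ℚ (W k)]
  [∀ k, FiniteDimensional ℚ (W k)]

/-- **ONE TYPE ON A TRANSITIVE SLOT** (`X = Hom(K, ℂ)` for any CM field `K`, `H = Stab(x₀)`):
`dim U(Φ) = Σ_k d_k · (dim A_{Φ,k} W_k^H / δ_k)` with `A_{Φ,k} = Σ_x u_1(Φ)(x) π_k(s x)` — Mai's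
`rank(K, S) − 1 = Σ_π d_π rank π(τ)` for a NON-GALOIS field, over `ℚ`. [cite: Mai1989, §2 Prop. 1 (proof)] -/
theorem finrank_antiSpan_eq_sum_finrank_map (Φ : Set X) {x₀ : X} {s : X → G} (hs : ∀ x, s x • x₀ = x)
    (π : ∀ k, Representation ℚ G (W k)) (hirr : ∀ k, (π k).IsIrreducible)
    (hne : ∀ k l, k ≠ l → ∀ S : (π k).IntertwiningMap (π l), S = 0)
    (hcov : ∀ P : Submodule ℚ (X → ℚ), P ≤ antiSpan G Φ → P ≠ ⊥ →
      (∀ (g : G) (f : X → ℚ), f ∈ P → (fun x => f (g • x)) ∈ P) →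
      ∃ k, ∃ T : (X → ℚ) →ₗ[ℚ] W k,
        (∀ (g : G) (f : X → ℚ), T (fun x => f (g⁻¹ • x)) = π k g (T f)) ∧ ∃ f ∈ P, T f ≠ 0) :
    Module.finrank ℚ (antiSpan G Φ) = ∑ k, Module.finrank ℚ (W k) *
      (Module.finrank ℚ ((Representation.invariants ((π k).comp (MulAction.stabilizer G x₀).subtype)).map
          (∑ x, antiVec Φ (1 : G) x • π k (s x))) /
        Module.finrank ℚ ((π k).IntertwiningMap (π k))) := by
  rw [(finrank_antiSpan_eq_sum Φ π hirr hne hcov).2]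
  exact Finset.sum_congr rfl fun k _ => by rw [finrank_evalSpace_eq_finrank_map (π k) hs]

variable {I : Type u} {E : I → Type v} [∀ i, MulAction G (E i)] [Fintype I] [∀ i, Fintype (E i)]
  [∀ i, DecidableEq (E i)]

/-- **FAMILIES WITH TRANSITIVE SLOTS** (`E_i = Hom(K_i, ℂ)` for any CM fields `K_i`, base points `x_i`, sections
`s_i`, stabilisers `H_i`):  **`dim U(Σ) = Σ_k d_k · (dim Σ_i A_{i,k} W_k^{H_i} / δ_k)`**,
`A_{i,k} = Σ_{x ∈ E_i} u_1(Φ_i)(x) π_k(s_i x)` — on Hodge groups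
`dim Hg(∏_i A_i) = Σ_π (d_π/δ_π) · dim Σ_i A_{Φ_i} V_π^{H_i}`. [cite: Mai1989, §2 Prop. 1 (proof)] [cite: Kubota1965, Lemma 2] -/
theorem finrank_antiSpan_sigmaType_eq_sum_finrank_map (Φ : ∀ i, Set (E i)) (x : ∀ i, E i) (s : ∀ i, E i → G)
    (hs : ∀ i y, s i y • x i = y) (π : ∀ k, Representation ℚ G (W k)) (hirr : ∀ k, (π k).IsIrreducible)
    (hne : ∀ k l, k ≠ l → ∀ S : (π k).IntertwiningMap (π l), S = 0)
    (hcov : ∀ P : Submodule ℚ ((Σ i, E i) → ℚ), P ≤ antiSpan G (sigmaType Φ) → P ≠ ⊥ →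
      (∀ (g : G) (f : (Σ i, E i) → ℚ), f ∈ P → (fun y => f (g • y)) ∈ P) →
      ∃ k, ∃ T : ((Σ i, E i) → ℚ) →ₗ[ℚ] W k,
        (∀ (g : G) (f : (Σ i, E i) → ℚ), T (fun y => f (g⁻¹ • y)) = π k g (T f)) ∧ ∃ f ∈ P, T f ≠ 0) :
    Module.finrank ℚ (antiSpan G (sigmaType Φ)) = ∑ k, Module.finrank ℚ (W k) *
      (Module.finrank ℚ (⨆ i, (Representation.invariants ((π k).comp (MulAction.stabilizer G (x i)).subtype)).map
          (∑ y, antiVec (Φ i) (1 : G) y • π k (s i y)) : Submodule ℚ (W k)) /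
        Module.finrank ℚ ((π k).IntertwiningMap (π k))) := by
  rw [(finrank_antiSpan_sigmaType_eq_sum Φ π hirr hne hcov).2]
  refine Finset.sum_congr rfl fun k _ => ?_
  have h : (⨆ i, Ev[G, π k, antiVec (Φ i) (1 : G)] : Submodule ℚ (W k)) =
      ⨆ i, (Representation.invariants ((π k).comp (MulAction.stabilizer G (x i)).subtype)).map
        (∑ y, antiVec (Φ i) (1 : G) y • π k (s i y)) :=
    iSup_congr fun i => evalSpace_eq_map_invariants (π k) (hs i) _
  rw [h]

end Formula

end Summit.HodgeConjecture.CorCM.IrrOdd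

namespace Summit.HodgeConjecture.CorCM

open Literature.NumberTheory.ComplexMultiplication
open Literature.AlgebraicGeometry.Motives (CMType)
open Literature.AlgebraicGeometry.Pohlmann1968

/-- The evaluation space `Ev[G, π, w] = {T w : T equivariant}` (local notation, no definition). -/
local notation3 (prettyPrint := false) "Ev[" G' ", " π ", " w "]" =>
  Submodule.span ℚ {v | ∃ T : (_ → ℚ) →ₗ[ℚ] _,
    (∀ (g : G') (f : _ → ℚ), T (fun x => f (g⁻¹ • x)) = π g (T f)) ∧ T w = v}

variable {I : Type} [Fintype I] {K : I → Type} [∀ i, Field (K i)] [∀ i, NumberField (K i)] [∀ i, IsCMField (K i)]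
  {κ : Type u'} [Fintype κ] {V : κ → Type*} [∀ k, AddCommGroup (V k)] [∀ k, Module ℚ (V k)]
  [∀ k, FiniteDimensional ℚ (V k)]

/-! ### §1 The multiplicity formula for `dim MT(∏_i A_i)` -/

/-- **`dim MT(∏_i A_i) = 1 + Σ_k d_k · (dim Σ_i Ev_i(π_k) / δ_k)`** for pairwise non-isomorphic irreducible
`ℚ`-representations `(π_k, V_k)` of `Aut(ℂ)` covering `U(Σ)` (any CM fields `K_i`, any types), with
`δ_k ∣ dim Σ_i Ev_i(π_k)`; `Ev_i(π) = {T(u_1(Φ_i)) : T : ℚ^{Hom(K_i,ℂ)} → V equivariant}`.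
[cite: Mai1989, §2 Prop. 1 (proof)] [cite: Deligne1982HodgeCycles, I Ex. 3.7 (c)] -/
theorem cmFamilyRank_eq_sum_add_one [Nonempty I] (Φ : ∀ i, CMType (K i))
    (π : ∀ k, Representation ℚ (ℂ ≃+* ℂ) (V k)) (hirr : ∀ k, (π k).IsIrreducible)
    (hne : ∀ k l, k ≠ l → ∀ S : (π k).IntertwiningMap (π l), S = 0)
    (hcov : ∀ P : Submodule ℚ ((Σ i, (K i →+* ℂ)) → ℚ), P ≤ antiSpan (ℂ ≃+* ℂ) (CMAlgebra.familyType Φ) → P ≠ ⊥ →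
      (∀ (g : ℂ ≃+* ℂ) (f : (Σ i, (K i →+* ℂ)) → ℚ), f ∈ P → (fun x => f (g • x)) ∈ P) →
      ∃ k, ∃ T : ((Σ i, (K i →+* ℂ)) → ℚ) →ₗ[ℚ] V k,
        (∀ (g : ℂ ≃+* ℂ) (f : (Σ i, (K i →+* ℂ)) → ℚ), T (fun x => f (g⁻¹ • x)) = π k g (T f)) ∧
          ∃ f ∈ P, T f ≠ 0) :
    (∀ k, Module.finrank ℚ ((π k).IntertwiningMap (π k)) ∣
        Module.finrank ℚ (⨆ i, Ev[ℂ ≃+* ℂ, π k, antiVec (Φ i).1 (1 : ℂ ≃+* ℂ)] : Submodule ℚ (V k))) ∧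
      CMAlgebra.cmFamilyRank Φ = 1 + ∑ k, Module.finrank ℚ (V k) *
        (Module.finrank ℚ (⨆ i, Ev[ℂ ≃+* ℂ, π k, antiVec (Φ i).1 (1 : ℂ ≃+* ℂ)] : Submodule ℚ (V k)) /
          Module.finrank ℚ ((π k).IntertwiningMap (π k))) := by
  obtain ⟨i₀⟩ := ‹Nonempty I›
  obtain ⟨s₀⟩ : Nonempty (K i₀ →+* ℂ) := inferInstance
  haveI : Nonempty (Σ i, (K i →+* ℂ)) := ⟨⟨i₀, s₀⟩⟩
  exact ⟨(IrrOdd.finrank_antiSpan_sigmaType_eq_sum (E := fun i => K i →+* ℂ) (fun i => (Φ i).1) π hirr hne hcov).1,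
    IrrOdd.typeRank_sigmaType_eq_sum_add_one (E := fun i => K i →+* ℂ) (Φ := fun i => (Φ i).1)
      (fun i => isCMTypeWith_conj (Φ i)) π hirr hne hcov⟩

/-- **ONE CM field: `dim MT(A_Φ) = 1 + Σ_k d_k · (dim Ev_Φ(π_k) / δ_k)`**, `δ_k ∣ dim Ev_Φ(π_k)` — Mai's
`rank(K, S) = 1 + Σ_π d_π rank π(τ)` for a non-Galois `K`, over `ℚ`. [cite: Mai1989, §2 Prop. 1 (proof)] [cite: Gordon1999HodgeAVSurvey, 9.4.4] -/
theorem cmTypeRank_eq_sum_add_one {L : Type} [Field L] [NumberField L] [IsCMField L] (Φ : CMType L)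
    (π : ∀ k, Representation ℚ (ℂ ≃+* ℂ) (V k)) (hirr : ∀ k, (π k).IsIrreducible)
    (hne : ∀ k l, k ≠ l → ∀ S : (π k).IntertwiningMap (π l), S = 0)
    (hcov : ∀ P : Submodule ℚ ((L →+* ℂ) → ℚ), P ≤ antiSpan (ℂ ≃+* ℂ) Φ.1 → P ≠ ⊥ →
      (∀ (g : ℂ ≃+* ℂ) (f : (L →+* ℂ) → ℚ), f ∈ P → (fun x => f (g • x)) ∈ P) →
      ∃ k, ∃ T : ((L →+* ℂ) → ℚ) →ₗ[ℚ] V k,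
        (∀ (g : ℂ ≃+* ℂ) (f : (L →+* ℂ) → ℚ), T (fun x => f (g⁻¹ • x)) = π k g (T f)) ∧ ∃ f ∈ P, T f ≠ 0) :
    (∀ k, Module.finrank ℚ ((π k).IntertwiningMap (π k)) ∣
        Module.finrank ℚ Ev[ℂ ≃+* ℂ, π k, antiVec Φ.1 (1 : ℂ ≃+* ℂ)]) ∧
      cmTypeRank Φ = 1 + ∑ k, Module.finrank ℚ (V k) *
        (Module.finrank ℚ Ev[ℂ ≃+* ℂ, π k, antiVec Φ.1 (1 : ℂ ≃+* ℂ)] /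
          Module.finrank ℚ ((π k).IntertwiningMap (π k))) := by
  haveI : Nonempty (L →+* ℂ) := inferInstance
  exact ⟨(IrrOdd.finrank_antiSpan_eq_sum Φ.1 π hirr hne hcov).1,
    IrrOdd.typeRank_eq_sum_add_one (isCMTypeWith_conj Φ) π hirr hne hcov⟩

/-! ### §2 The computable form on the transitive slots `Hom(K_i, ℂ)` -/

omit [Fintype I] [∀ i, IsCMField (K i)] in
/-- **Sections exist**: `Hom(K_i, ℂ)` is one `Aut(ℂ)`-orbit, so for base embeddings `x_i` there are `s_i` with
`s_i(y) ∘ x_i = y`. [cite: Gordon1999HodgeAVSurvey, §9.2 (proof)] -/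
theorem exists_section_embeddings (x : ∀ i, K i →+* ℂ) :
    ∃ s : ∀ i, (K i →+* ℂ) → (ℂ ≃+* ℂ), ∀ i y, s i y • x i = y := by
  have h : ∀ i (y : K i →+* ℂ), ∃ g : ℂ ≃+* ℂ, g • x i = y := fun i y =>
    (isPretransitive_ringEquiv_complex (K := K i)).exists_smul_eq (x i) y
  choose s hs using h
  exact ⟨s, hs⟩

/-- **THE COMPUTABLE FORM**: with base embeddings `x_i`, sections `s_i` and stabilisers `H_i = Stab(x_i)`,
**`dim MT(∏_i A_i) = 1 + Σ_k d_k · (dim Σ_i A_{i,k} V_k^{H_i} / δ_k)`**, `A_{i,k} = Σ_{y} u_1(Φ_i)(y) π_k(s_i y)` on the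
`H_i`-invariants `V_k^{H_i}` (Frobenius reciprocity). [cite: Mai1989, §2 Prop. 1 (proof)] [cite: Kubota1965, Lemma 2] -/
theorem cmFamilyRank_eq_sum_finrank_map_add_one [Nonempty I] (Φ : ∀ i, CMType (K i)) (x : ∀ i, K i →+* ℂ)
    (s : ∀ i, (K i →+* ℂ) → (ℂ ≃+* ℂ)) (hs : ∀ i y, s i y • x i = y)
    (π : ∀ k, Representation ℚ (ℂ ≃+* ℂ) (V k)) (hirr : ∀ k, (π k).IsIrreducible)
    (hne : ∀ k l, k ≠ l → ∀ S : (π k).IntertwiningMap (π l), S = 0)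
    (hcov : ∀ P : Submodule ℚ ((Σ i, (K i →+* ℂ)) → ℚ), P ≤ antiSpan (ℂ ≃+* ℂ) (CMAlgebra.familyType Φ) → P ≠ ⊥ →
      (∀ (g : ℂ ≃+* ℂ) (f : (Σ i, (K i →+* ℂ)) → ℚ), f ∈ P → (fun y => f (g • y)) ∈ P) →
      ∃ k, ∃ T : ((Σ i, (K i →+* ℂ)) → ℚ) →ₗ[ℚ] V k,
        (∀ (g : ℂ ≃+* ℂ) (f : (Σ i, (K i →+* ℂ)) → ℚ), T (fun y => f (g⁻¹ • y)) = π k g (T f)) ∧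
          ∃ f ∈ P, T f ≠ 0) :
    CMAlgebra.cmFamilyRank Φ = 1 + ∑ k, Module.finrank ℚ (V k) *
      (Module.finrank ℚ (⨆ i, (Representation.invariants
            ((π k).comp (MulAction.stabilizer (ℂ ≃+* ℂ) (x i)).subtype)).map
          (∑ y, antiVec (Φ i).1 (1 : ℂ ≃+* ℂ) y • π k (s i y)) : Submodule ℚ (V k)) /
        Module.finrank ℚ ((π k).IntertwiningMap (π k))) := by
  classical
  obtain ⟨i₀⟩ := ‹Nonempty I›
  obtain ⟨s₀⟩ : Nonempty (K i₀ →+* ℂ) := inferInstance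
  haveI : Nonempty (Σ i, (K i →+* ℂ)) := ⟨⟨i₀, s₀⟩⟩
  change typeRank (ℂ ≃+* ℂ) (sigmaType fun i => (Φ i).1) = _
  rw [(IsCMTypeWith.sigmaType fun i => isCMTypeWith_conj (Φ i)).typeRank_eq_finrank_antiSpan_add_one,
    IrrOdd.finrank_antiSpan_sigmaType_eq_sum_finrank_map (E := fun i => K i →+* ℂ) (fun i => (Φ i).1) x s hs π
      hirr hne hcov, add_comm]

/-! ### §3 Mai's lower bound for products -/

/-- **MAI'S PROP. 1 FOR PRODUCTS OF CM ABELIAN VARIETIES**: `dim MT(∏_i A_i) ≥ 1 + Σ_{π touched} d_π`, a `π_k`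
being touched when some factor has `Ev_i(π_k) ≠ 0`. [cite: Mai1989, §2 Prop. 1] [cite: Gordon1999HodgeAVSurvey, 9.4.4] -/
theorem one_add_sum_filter_le_cmFamilyRank [Nonempty I] [DecidableEq I] (Φ : ∀ i, CMType (K i))
    (π : ∀ k, Representation ℚ (ℂ ≃+* ℂ) (V k)) (hirr : ∀ k, (π k).IsIrreducible)
    (hne : ∀ k l, k ≠ l → ∀ S : (π k).IntertwiningMap (π l), S = 0)
    (hcov : ∀ P : Submodule ℚ ((Σ i, (K i →+* ℂ)) → ℚ), P ≤ antiSpan (ℂ ≃+* ℂ) (CMAlgebra.familyType Φ) → P ≠ ⊥ →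
      (∀ (g : ℂ ≃+* ℂ) (f : (Σ i, (K i →+* ℂ)) → ℚ), f ∈ P → (fun y => f (g • y)) ∈ P) →
      ∃ k, ∃ T : ((Σ i, (K i →+* ℂ)) → ℚ) →ₗ[ℚ] V k,
        (∀ (g : ℂ ≃+* ℂ) (f : (Σ i, (K i →+* ℂ)) → ℚ), T (fun y => f (g⁻¹ • y)) = π k g (T f)) ∧
          ∃ f ∈ P, T f ≠ 0) :
    1 + ∑ k ∈ Finset.univ.filter (fun k => ∃ i, Ev[ℂ ≃+* ℂ, π k, antiVec (Φ i).1 (1 : ℂ ≃+* ℂ)] ≠ ⊥),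
        Module.finrank ℚ (V k) ≤ CMAlgebra.cmFamilyRank Φ := by
  classical
  obtain ⟨i₀⟩ := ‹Nonempty I›
  obtain ⟨s₀⟩ : Nonempty (K i₀ →+* ℂ) := inferInstance
  haveI : Nonempty (Σ i, (K i →+* ℂ)) := ⟨⟨i₀, s₀⟩⟩
  change _ ≤ typeRank (ℂ ≃+* ℂ) (sigmaType fun i => (Φ i).1)
  rw [(IsCMTypeWith.sigmaType fun i => isCMTypeWith_conj (Φ i)).typeRank_eq_finrank_antiSpan_add_one, add_comm]
  exact Nat.add_le_add_right (IrrOdd.sum_filter_finrank_le_finrank_antiSpan_sigmaType (E := fun i => K i →+* ℂ)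
    (fun i => (Φ i).1) π hirr hne hcov) 1

end Summit.HodgeConjecture.CorCM

end
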